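import Summits.CriticalPhenomena.PercolationContinuityZ3.Theorems.PercNearOneGluingNoHeavyLowerTailSunflowerCubeGladkovRank
import Summits.CriticalPhenomena.PercolationContinuityZ3.Theorems.PercNearOneGluingNoHeavyLowerTailSunflowerStarMatching
import HarnessLib
import HarnessLib.Audit

/-!
# `NoHeavyLowerTail` (crux stmt-CriticalPhenomena-4575), abstract sunflower cubic: the DUAL cube theorem and the KERNEL LEMMAS behind the
# two-stage rainbow vectors (part 3 of the GF(2) programme for ★)

Support file (seat `prim-l12-p2` gen 18; `--supports stmt-CriticalPhenomena-4575`).  No `sorry`, no new definitions.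
Memo: run/shared/lean/prim/prim-l12/prim-l12-p2/FINDING-g18-CUBE-GLADKOV-RANK.md §8.

With `M(Y,O) = #{R' ∈ B : O ⊆ R' ⊆ Y}` and `N(O,Y″) = #{R ∈ A : τY″ ⊆ R ⊆ τO}` (cube `W`, `τ = W ∖ ·`), part 1 proved `M·N ≡ I` off one block
(`Sunflower.crossKey`) and part 2 that `M` has full row rank on the cross pairs `CR(W)`.  Here:
* `Sunflower.cross_kernel_trivial_dual` — `N` has full COLUMN rank on `CR(W)`: the other half of `M·N = I + E` (first the columns `Y` with
  `lab Y = 3` — for them every row satisfies the hypothesis of `crossKey` — then the columns of type `(1|2)`).  Equivalently the matrix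
  `M^A(Y,O) = #{R ∈ A : τY ⊆ R ⊆ τO}` (kernel-side interval counts) has full row rank; this is the form used on KERNEL-spectator cubes.
* KERNEL LEMMAS (`Sunflower.nu_mem_ker`, `Sunflower.mu_mem_ker`), both literal instances of `crossKey` with a non-cross second argument:
  (i) for `P ∈ C₁`, `P ⊆ W`, `W∖P ∈ A`: the vector `ν_P(O) = #{R ∈ A : P ⊆ R ⊆ W∖O}` is killed by every `M`-row `Y ∈ CR(W)`;
  (ii) for `Q ∈ C₃`, `Q ⊆ W`, `W∖Q ∈ B`: the vector `μ_Q(O) = #{R' ∈ B : O ⊆ R' ⊆ Q}` is killed by every `N`-column `Y ∈ CR(W)`.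
  These are the building blocks of the TWO-STAGE RAINBOW VECTORS `t_ρ = TS-B_ρ + TS-A_ρ` of the memo (§8), which lie in the common kernel of all
  spectator rows and are linearly independent in every instance of the census (n ≤ 4 exhaustive, 8·10⁴ random on 5–6 points, structured families
  on 7–8 points); their independence (`RainbowKernelIndependence`, typed conjecture below) implies ★ (`PartitionLemmaH`) by rank–nullity.
-/

namespace Summit.CriticalPhenomena.PercolationContinuityZ3.Theorems.SunflowerPartition

open Finset

namespace Sunflower

variable {α : Type*} [DecidableEq α] (F : Sunflower α)

/-! ## The dual cube theorem: `N` has full column rank -/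

/-- **DUAL CUBE THEOREM** (this work).  If a `GF(2)`-combination `μ` of the COLUMNS `N(·,Y″) = #{R ∈ A : W∖Y″ ⊆ R ⊆ W∖·}` (`Y″ ∈ CR(W)`)
vanishes on every kernel–bottom pair `O`, then `μ = 0`.  Equivalently the `CR × ABbot` matrix `#{R ∈ A : W∖Y ⊆ R ⊆ W∖O}` has full row rank. [this work] -/
theorem cross_kernel_trivial_dual (W : Finset α) (mu : Finset α → ZMod 2)
    (hmu : ∀ O ∈ W.powerset, F.lab O = 0 → F.lab (W \ O) = 4 →
      (∑ Y'' ∈ W.powerset.filter (fun Y => F.lab Y ≠ 0 ∧ F.lab Y ≠ 4 ∧ F.lab (W \ Y) ≠ 0 ∧ F.lab (W \ Y) ≠ 4 ∧ F.lab (W \ Y) < F.lab Y),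
        mu Y'' * (∑ R ∈ W.powerset, (if F.lab R = 4 ∧ W \ Y'' ⊆ R ∧ R ⊆ W \ O then (1 : ZMod 2) else 0))) = 0) :
    ∀ Y ∈ W.powerset.filter (fun Y => F.lab Y ≠ 0 ∧ F.lab Y ≠ 4 ∧ F.lab (W \ Y) ≠ 0 ∧ F.lab (W \ Y) ≠ 4 ∧ F.lab (W \ Y) < F.lab Y),
      mu Y = 0 := by
  set CR := W.powerset.filter (fun Y => F.lab Y ≠ 0 ∧ F.lab Y ≠ 4 ∧ F.lab (W \ Y) ≠ 0 ∧ F.lab (W \ Y) ≠ 4 ∧ F.lab (W \ Y) < F.lab Y)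
    with hCR
  have memCR : ∀ {Y}, Y ∈ CR ↔ Y ⊆ W ∧ F.lab Y ≠ 0 ∧ F.lab Y ≠ 4 ∧ F.lab (W \ Y) ≠ 0 ∧ F.lab (W \ Y) ≠ 4 ∧ F.lab (W \ Y) < F.lab Y := by
    intro Y; rw [hCR, mem_filter, mem_powerset]
  -- pair `hmu` against the row `M(Y,·)` and exchange: `Σ_{Y″} μ_{Y″} (M·N)(Y,Y″) = 0` for every `Y`
  have pair : ∀ Y : Finset α,
      (∑ Y'' ∈ CR, mu Y'' * (∑ O ∈ W.powerset,
        (∑ R' ∈ W.powerset, (if F.lab R' = 0 ∧ O ⊆ R' ∧ R' ⊆ Y then (1 : ZMod 2) else 0)) *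
        (∑ R ∈ W.powerset, (if F.lab R = 4 ∧ W \ Y'' ⊆ R ∧ R ⊆ W \ O then (1 : ZMod 2) else 0)))) = 0 := by
    intro Y
    have hO : ∀ O ∈ W.powerset,
        (∑ R' ∈ W.powerset, (if F.lab R' = 0 ∧ O ⊆ R' ∧ R' ⊆ Y then (1 : ZMod 2) else 0)) *
          (∑ Y'' ∈ CR, mu Y'' * (∑ R ∈ W.powerset, (if F.lab R = 4 ∧ W \ Y'' ⊆ R ∧ R ⊆ W \ O then (1 : ZMod 2) else 0))) = 0 := by
      intro O hO
      by_cases h0 : F.lab O = 0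
      · by_cases h4 : F.lab (W \ O) = 4
        · rw [hmu O hO h0 h4, mul_zero]
        · rw [show (∑ Y'' ∈ CR, mu Y'' * (∑ R ∈ W.powerset, (if F.lab R = 4 ∧ W \ Y'' ⊆ R ∧ R ⊆ W \ O then (1 : ZMod 2) else 0))) = 0
            from sum_eq_zero fun Y'' _ => by rw [F.crossN_eq_zero_of_lab_ne W h4, mul_zero], mul_zero]
      · rw [F.crossM_eq_zero_of_lab_ne W h0, zero_mul]
    calc (∑ Y'' ∈ CR, mu Y'' * (∑ O ∈ W.powerset,
          (∑ R' ∈ W.powerset, (if F.lab R' = 0 ∧ O ⊆ R' ∧ R' ⊆ Y then (1 : ZMod 2) else 0)) *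
          (∑ R ∈ W.powerset, (if F.lab R = 4 ∧ W \ Y'' ⊆ R ∧ R ⊆ W \ O then (1 : ZMod 2) else 0))))
        = ∑ O ∈ W.powerset, (∑ R' ∈ W.powerset, (if F.lab R' = 0 ∧ O ⊆ R' ∧ R' ⊆ Y then (1 : ZMod 2) else 0)) *
            (∑ Y'' ∈ CR, mu Y'' * (∑ R ∈ W.powerset, (if F.lab R = 4 ∧ W \ Y'' ⊆ R ∧ R ⊆ W \ O then (1 : ZMod 2) else 0))) := by
          rw [show (∑ Y'' ∈ CR, mu Y'' * (∑ O ∈ W.powerset,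
              (∑ R' ∈ W.powerset, (if F.lab R' = 0 ∧ O ⊆ R' ∧ R' ⊆ Y then (1 : ZMod 2) else 0)) *
              (∑ R ∈ W.powerset, (if F.lab R = 4 ∧ W \ Y'' ⊆ R ∧ R ⊆ W \ O then (1 : ZMod 2) else 0))))
            = ∑ Y'' ∈ CR, ∑ O ∈ W.powerset, mu Y'' *
              ((∑ R' ∈ W.powerset, (if F.lab R' = 0 ∧ O ⊆ R' ∧ R' ⊆ Y then (1 : ZMod 2) else 0)) *
              (∑ R ∈ W.powerset, (if F.lab R = 4 ∧ W \ Y'' ⊆ R ∧ R ⊆ W \ O then (1 : ZMod 2) else 0))) from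
            sum_congr rfl fun Y'' _ => Finset.mul_sum _ _ _]
          rw [Finset.sum_comm]
          refine sum_congr rfl fun O _ => ?_
          rw [Finset.mul_sum]
          exact sum_congr rfl fun Y'' _ => by ring
      _ = 0 := sum_eq_zero hO
  -- step 1: columns with `lab Y = 3`: every `Y″` has `lab (W ∖ Y″) ∈ {1,2} ≠ 3`
  have step1 : ∀ Y ∈ CR, F.lab Y = 3 → mu Y = 0 := by
    intro Y hY h3
    obtain ⟨hYW, hY0, hY4, hcY0, hcY4, -⟩ := memCR.1 hY
    have h := pair Y
    rw [show (∑ Y'' ∈ CR, mu Y'' * (∑ O ∈ W.powerset,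
          (∑ R' ∈ W.powerset, (if F.lab R' = 0 ∧ O ⊆ R' ∧ R' ⊆ Y then (1 : ZMod 2) else 0)) *
          (∑ R ∈ W.powerset, (if F.lab R = 4 ∧ W \ Y'' ⊆ R ∧ R ⊆ W \ O then (1 : ZMod 2) else 0))))
        = ∑ Y'' ∈ CR, (if Y = Y'' then mu Y'' else 0) by
      refine sum_congr rfl fun Y'' hY'' => ?_
      obtain ⟨hY''W, hY''0, hY''4, hc0, hc4, hlt⟩ := memCR.1 hY''
      have hne : F.lab (W \ Y'') ≠ F.lab Y := by
        rw [h3]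
        rcases petal_lt_cases _ _ hc0 hc4 hY''0 hY''4 hlt with ⟨h, -⟩ | ⟨h, -⟩ <;> rw [h] <;> decide
      rw [F.crossKey W hYW hY''W hY4 hcY4 hY''0 hc0 hc4 hne, mul_ite, mul_one, mul_zero]] at h
    rwa [Finset.sum_ite_eq CR Y mu, if_pos hY] at h
  -- step 2: the remaining columns have type `(1|2)`
  intro Y hY
  obtain ⟨hYW, hY0, hY4, hcY0, hcY4, hlt⟩ := memCR.1 hY
  rcases petal_lt_cases _ _ hcY0 hcY4 hY0 hY4 hlt with ⟨h1, h2 | h3⟩ | ⟨-, h3⟩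
  · have h := pair Y
    rw [show (∑ Y'' ∈ CR, mu Y'' * (∑ O ∈ W.powerset,
          (∑ R' ∈ W.powerset, (if F.lab R' = 0 ∧ O ⊆ R' ∧ R' ⊆ Y then (1 : ZMod 2) else 0)) *
          (∑ R ∈ W.powerset, (if F.lab R = 4 ∧ W \ Y'' ⊆ R ∧ R ⊆ W \ O then (1 : ZMod 2) else 0))))
        = ∑ Y'' ∈ CR, (if Y = Y'' then mu Y'' else 0) by
      refine sum_congr rfl fun Y'' hY'' => ?_
      obtain ⟨hY''W, hY''0, hY''4, hc0, hc4, hlt''⟩ := memCR.1 hY''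
      rcases petal_lt_cases _ _ hc0 hc4 hY''0 hY''4 hlt'' with ⟨hc1, -⟩ | ⟨hc2, hj3⟩
      · have hne : F.lab (W \ Y'') ≠ F.lab Y := by rw [hc1, h2]; decide
        rw [F.crossKey W hYW hY''W hY4 hcY4 hY''0 hc0 hc4 hne, mul_ite, mul_one, mul_zero]
      · -- `Y″` of type `(2|3)`: coefficient already zero
        rw [step1 Y'' hY'' hj3, zero_mul, if_neg]
        rintro rfl
        rw [hj3] at h2; exact absurd h2 (by decide)] at h
    rwa [Finset.sum_ite_eq CR Y mu, if_pos hY] at h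
  · exact step1 Y hY h3
  · exact step1 Y hY h3

/-! ## Kernel lemmas: free kernel vectors from `(1|4)` pairs (for `M`) and `(3|0)` pairs (for `N`) -/

/-- **KERNEL LEMMA (i)** (this work): for `P ⊆ W` with `lab P = 1` and `lab (W ∖ P) = 4`, the vector `ν_P(O) = #{R ∈ A : P ⊆ R ⊆ W∖O}` is
orthogonal to the `M`-row of every cross pair `Y` of `W` (`lab Y ∈ {2,3}` petal, `lab (W∖Y)` a smaller petal):
`Σ_O M(Y,O)·ν_P(O) = 0`.  (`crossKey` with second argument `W ∖ P`.) [this work] -/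
theorem nu_mem_ker (W : Finset α) {Y P : Finset α} (hY : Y ⊆ W) (hP : P ⊆ W) (hY4 : F.lab Y ≠ 4) (hcY4 : F.lab (W \ Y) ≠ 4) (hY1 : F.lab Y ≠ 1)
    (hP1 : F.lab P = 1) (hcP : F.lab (W \ P) = 4) :
    (∑ O ∈ W.powerset,
        (∑ R' ∈ W.powerset, (if F.lab R' = 0 ∧ O ⊆ R' ∧ R' ⊆ Y then (1 : ZMod 2) else 0)) *
        (∑ R ∈ W.powerset, (if F.lab R = 4 ∧ P ⊆ R ∧ R ⊆ W \ O then (1 : ZMod 2) else 0))) = 0 := by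
  have hWP : W \ (W \ P) = P := Finset.sdiff_sdiff_eq_self hP
  have key := F.crossKey W (Y := Y) (Y'' := W \ P) hY sdiff_subset hY4 hcY4 (by rw [hcP]; decide)
    (by rw [hWP, hP1]; decide) (by rw [hWP, hP1]; decide) (by rw [hWP, hP1]; exact fun h => hY1 h.symm)
  rw [hWP] at key
  rw [key, if_neg]
  rintro rfl
  exact hY4 hcP

/-- **KERNEL LEMMA (ii)** (this work): for `Q ⊆ W` with `lab Q = 3` and `lab (W ∖ Q) = 0`, the vector `μ_Q(O) = #{R' ∈ B : O ⊆ R' ⊆ Q}` is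
orthogonal to the `N`-column of every cross pair `Y` of `W`: `Σ_O μ_Q(O)·N(O,Y) = 0`.  (`crossKey` with first argument `Q`.) [this work] -/
theorem mu_mem_ker (W : Finset α) {Y Q : Finset α} (hY : Y ⊆ W) (hQ : Q ⊆ W)
    (hY0 : F.lab Y ≠ 0) (hcY0 : F.lab (W \ Y) ≠ 0) (hcY4 : F.lab (W \ Y) ≠ 4) (hcY3 : F.lab (W \ Y) ≠ 3)
    (hQ3 : F.lab Q = 3) (hcQ : F.lab (W \ Q) = 0) :
    (∑ O ∈ W.powerset,
        (∑ R' ∈ W.powerset, (if F.lab R' = 0 ∧ O ⊆ R' ∧ R' ⊆ Q then (1 : ZMod 2) else 0)) *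
        (∑ R ∈ W.powerset, (if F.lab R = 4 ∧ W \ Y ⊆ R ∧ R ⊆ W \ O then (1 : ZMod 2) else 0))) = 0 := by
  have key := F.crossKey W (Y := Q) (Y'' := Y) hQ hY (by rw [hQ3]; decide) (by rw [hcQ]; decide) hY0 hcY0 hcY4
    (by rw [hQ3]; exact hcY3)
  rw [key, if_neg]
  rintro rfl
  exact hcY0 hcQ

end Sunflower

end Summit.CriticalPhenomena.PercolationContinuityZ3.Theorems.SunflowerPartition
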